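import Literature.NumberTheory.LocalFields.ResiduallySeparableCommutantOrder
import HarnessLib

/-!
# The unitary involution `x ↦ J⁻¹ ᵗ(σx) J` on the commutant order `𝒪_E[γ]` and Kottwitz's norm equation `s · τ(s) = u` in `𝒪_E[γ]ˣ`
# (Kottwitz (1986) Prop. 7.1; Rogawski (1990) §4.3 p. 43)

Topic `NumberTheory/LocalFields`; namespace `Literature.NumberTheory.LocalFields`. THEOREMS ONLY (no definition, no instance, no notation, no named fact).
Cell `hodgecm-mathlib`, F0∕P3a road letter «D-S3u», brick «D-S3u-K2» (FILE 2 of LEAD F0P3a-plan (g8) T7-51 (o4); consumer: the floor-2 discharge of A-p01 (g19)'s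
binder `hK1` — «the `G`-class of a residually regular semisimple `γ ∈ U(J)(𝒪)` meets `U(J)(𝒪)` in one class»: an integral `GL`-conjugator `k₀` is corrected to a
unitary one by solving `s · τ(s) = τ(k₀) k₀` in `𝒪[γ]ˣ`).  Over ★ K1 `ResiduallySeparableCommutantOrder` (the commutative model `AdjoinRoot χ_γ ≃ₐ Z_{M_N(𝒪)}(γ)`
and the norm equation `exists_mul_map_eq_adjoinRoot` on it).

DEF-FREE CURRENCY: the adjoint involution is WRITTEN OUT as `J⁻¹ * (x.map σO)ᵀ * J` (`J⁻¹` = Mathlib's `Matrix.nonsing_inv`, a true inverse as `det J ∈ Rˣ`);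
`σO : R →+* R` is any ring involution (at an inert place of a quadratic `E ∕ F` the consumer passes the restriction of `Gal(E_w ∕ F_v)` to `𝒪_w`, as in ★ p838550).

* §1 ALGEBRA over any commutative ring `R` (`hJu : IsUnit J.det`): `mul_adj_eq` (`J · adj x = ᵗ(σx) J`), `adj_mul` (ANTI-multiplicative), `adj_add`, `adj_one`,
  `adj_algebraMap` (`adj (c·1) = σ(c)·1`), **`adj_adj`** (an INVOLUTION when `ᵗ(σJ) = J` and `σ² = id`; proof transposes-and-`σ`'s the identity `J·adj x = ᵗ(σx) J`,
  so `σ(J⁻¹)` never appears), `adj_mul_self_of_unitary` (`adj γ · γ = 1` for `ᵗ(σγ) J γ = J`), **`commute_adj_of_commute`** (`Z(γ)` is `adj`-stable for unitary `γ`).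
* §2 THE NORM EQUATION over `𝒪_E` (`E` non-archimedean local, `γ` residually separable `hsep`, unitary `hγ`, `hmove : ∃ c, IsUnit (σO c − c)` — at an inert place
  ★ `exists_isUnit_map_sub_of_residueHom_ne`): **`exists_ringHom_adjoinRoot_adj`** — the involution transported to a RING involution `σ'` of `AdjoinRoot χ_γ` along
  ★ K1's `e` (`e (σ' z) = adj (e z)`, `σ' ∘ σ' = id`, `σ' (of m) = of (σO m)`), and **`exists_commute_mul_adj_eq`**: for every `u ∈ Z(γ)` with `det u ∈ 𝒪ˣ` and
  `adj u = u` there is `s ∈ Z(γ)` with `det s ∈ 𝒪ˣ` and `s · adj s = u` (★ K1 `exists_mul_map_eq_adjoinRoot`: `σ'` preserves `𝔪 · AdjoinRoot χ` because a ring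
  involution of the local ring `𝒪` preserves `𝔪`, and moves the scalar `of c` by the unit `of (σO c − c)`).
NOT here: the group-theoretic wrap `k₀ ↦ k₀ s⁻¹` producing the unitary integral conjugator (it needs the D-S3c integral `GL`-conjugacy letter), i.e. `hK1` itself.

## References
* [Kottwitz1986] R. E. Kottwitz, *Base change for unit elements of Hecke algebras*, Compositio Math. 60 (1986), §7 Prop. 7.1.
* [Rogawski1990] J. D. Rogawski, *Automorphic Representations of Unitary Groups in Three Variables* (1990), §4.3 p. 43.
* [Serre1979] J.-P. Serre, *Local Fields* (1979), Ch. V §2 Prop. 3.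
-/

set_option autoImplicit false

noncomputable section

open Polynomial IsLocalRing ValuativeRel Matrix

namespace Literature.NumberTheory.LocalFields

/-! ### §1 The adjoint anti-involution `x ↦ J⁻¹ ᵗ(σx) J` over a commutative ring -/

section Adjoint

variable {R : Type*} [CommRing R] {n : Type*} [Fintype n] [DecidableEq n] (σO : R →+* R) (J : Matrix n n R)

/-- `J · (J⁻¹ ᵗ(σx) J) = ᵗ(σx) · J` for `det J ∈ Rˣ`. [cite: Rogawski1990, §4.3 p. 43] -/
theorem mul_adj_eq (hJu : IsUnit J.det) (x : Matrix n n R) : J * (J⁻¹ * (x.map σO)ᵀ * J) = (x.map σO)ᵀ * J := by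
  rw [Matrix.mul_assoc, Matrix.mul_nonsing_inv_cancel_left _ _ hJu]

/-- **`adj` is ANTI-multiplicative**: `adj (x y) = adj y · adj x`. [cite: Rogawski1990, §4.3 p. 43] -/
theorem adj_mul (hJu : IsUnit J.det) (x y : Matrix n n R) :
    J⁻¹ * ((x * y).map σO)ᵀ * J = (J⁻¹ * (y.map σO)ᵀ * J) * (J⁻¹ * (x.map σO)ᵀ * J) := by
  simp only [Matrix.map_mul, Matrix.transpose_mul, Matrix.mul_assoc, Matrix.mul_nonsing_inv_cancel_left _ _ hJu]

omit [DecidableEq n] in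
/-- `adj` is additive. [cite: Rogawski1990, §4.3 p. 43] -/
theorem adj_add [DecidableEq n] (x y : Matrix n n R) :
    J⁻¹ * ((x + y).map σO)ᵀ * J = J⁻¹ * (x.map σO)ᵀ * J + J⁻¹ * (y.map σO)ᵀ * J := by
  rw [Matrix.map_add σO (map_add σO), Matrix.transpose_add, Matrix.mul_add, Matrix.add_mul]

/-- `adj 1 = 1`. [cite: Rogawski1990, §4.3 p. 43] -/
theorem adj_one (hJu : IsUnit J.det) : J⁻¹ * ((1 : Matrix n n R).map σO)ᵀ * J = 1 := by
  rw [Matrix.map_one σO (map_zero σO) (map_one σO), Matrix.transpose_one, Matrix.mul_one, Matrix.nonsing_inv_mul _ hJu]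

/-- `adj 0 = 0`. [cite: Rogawski1990, §4.3 p. 43] -/
theorem adj_zero : J⁻¹ * ((0 : Matrix n n R).map σO)ᵀ * J = 0 := by
  rw [Matrix.map_zero σO (map_zero σO), Matrix.transpose_zero, Matrix.mul_zero, Matrix.zero_mul]

/-- `adj (c · 1) = σ(c) · 1` — `adj` is `σ`-SEMILINEAR on scalars. [cite: Rogawski1990, §4.3 p. 43] -/
theorem adj_algebraMap (hJu : IsUnit J.det) (c : R) :
    J⁻¹ * ((algebraMap R (Matrix n n R) c).map σO)ᵀ * J = algebraMap R (Matrix n n R) (σO c) := by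
  rw [Matrix.algebraMap_eq_diagonal, Matrix.algebraMap_eq_diagonal, Matrix.diagonal_map (map_zero σO), Matrix.diagonal_transpose]
  simp only [Pi.algebraMap_def, Algebra.algebraMap_self_apply]
  rw [← Matrix.smul_one_eq_diagonal, Matrix.mul_smul, Matrix.mul_one, Matrix.smul_mul, Matrix.nonsing_inv_mul _ hJu]

/-- **`adj` is an involution** when `J` is `σ`-hermitian (`ᵗ(σJ) = J`) and `σ² = id`: `adj (adj x) = x`.  (Apply `σ` and transpose to `J · adj x = ᵗ(σx) J`:
`ᵗ(σ adj x) · J = J · x`.) [cite: Rogawski1990, §4.3 p. 43] [cite: Kottwitz1986, §7 Prop. 7.1] -/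
theorem adj_adj (hσσ : ∀ a, σO (σO a) = a) (hJ : (J.map σO)ᵀ = J) (hJu : IsUnit J.det) (x : Matrix n n R) :
    J⁻¹ * ((J⁻¹ * (x.map σO)ᵀ * J).map σO)ᵀ * J = x := by
  have hσσ' : ∀ M : Matrix n n R, (M.map σO).map σO = M := fun M => by
    ext i j; simp only [Matrix.map_apply, hσσ]
  -- `J y = ᵗ(σx) J`; apply `σ` and transpose: `ᵗ(σy) J = J x`
  have h1 : J * (J⁻¹ * (x.map σO)ᵀ * J) = (x.map σO)ᵀ * J := mul_adj_eq σO J hJu x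
  generalize hy : J⁻¹ * (x.map σO)ᵀ * J = y at h1 ⊢
  have h2 : ((J * y).map σO)ᵀ = (((x.map σO)ᵀ * J).map σO)ᵀ := by rw [h1]
  rw [Matrix.map_mul, Matrix.map_mul, Matrix.transpose_map, hσσ', Matrix.transpose_mul, Matrix.transpose_mul,
    Matrix.transpose_transpose, hJ] at h2
  -- `h2 : ᵗ(σy) * J = J * x`
  rw [Matrix.mul_assoc, h2, Matrix.nonsing_inv_mul_cancel_left _ _ hJu]

/-- **`adj γ · γ = 1` for unitary `γ`** (`ᵗ(σγ) J γ = J`): `adj γ = γ⁻¹`. [cite: Rogawski1990, §4.3 p. 43] -/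
theorem adj_mul_self_of_unitary (hJu : IsUnit J.det) {γ : Matrix n n R} (hγ : (γ.map σO)ᵀ * J * γ = J) :
    J⁻¹ * (γ.map σO)ᵀ * J * γ = 1 := by
  rw [Matrix.mul_assoc J⁻¹, Matrix.mul_assoc J⁻¹, hγ, Matrix.nonsing_inv_mul _ hJu]

/-- `γ · adj γ = 1` for unitary `γ`. [cite: Rogawski1990, §4.3 p. 43] -/
theorem self_mul_adj_of_unitary (hJu : IsUnit J.det) {γ : Matrix n n R} (hγ : (γ.map σO)ᵀ * J * γ = J) :
    γ * (J⁻¹ * (γ.map σO)ᵀ * J) = 1 :=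
  mul_eq_one_comm.1 (adj_mul_self_of_unitary σO J hJu hγ)

/-- **The commutant of a unitary `γ` is `adj`-stable**: `x γ = γ x ⇒ (adj x) γ = γ (adj x)` (`adj` reverses products and `adj γ = γ⁻¹`).
[cite: Kottwitz1986, §7 Prop. 7.1] [cite: Rogawski1990, §4.3 p. 43] -/
theorem commute_adj_of_commute (hJu : IsUnit J.det) {γ : Matrix n n R} (hγ : (γ.map σO)ᵀ * J * γ = J) {x : Matrix n n R}
    (hx : Commute γ x) : Commute γ (J⁻¹ * (x.map σO)ᵀ * J) := by
  set a := J⁻¹ * (γ.map σO)ᵀ * J with ha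
  set b := J⁻¹ * (x.map σO)ᵀ * J with hb
  -- `adj (γ x) = adj (x γ)` gives `b a = a b`
  have hab : b * a = a * b := by
    calc b * a = J⁻¹ * ((γ * x).map σO)ᵀ * J := (adj_mul σO J hJu γ x).symm
      _ = J⁻¹ * ((x * γ).map σO)ᵀ * J := by rw [hx.eq]
      _ = a * b := adj_mul σO J hJu x γ
  have haγ : a * γ = 1 := adj_mul_self_of_unitary σO J hJu hγ
  have hγa : γ * a = 1 := self_mul_adj_of_unitary σO J hJu hγ
  -- `γ b = γ b (a γ) = γ (a b) γ = b γ`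
  change γ * b = b * γ
  calc γ * b = γ * b * (a * γ) := by rw [haγ, Matrix.mul_one]
    _ = γ * (b * a) * γ := by simp only [Matrix.mul_assoc]
    _ = γ * (a * b) * γ := by rw [hab]
    _ = (γ * a) * b * γ := by simp only [Matrix.mul_assoc]
    _ = b * γ := by rw [hγa, Matrix.one_mul]

end Adjoint

/-! ### §2 The norm equation `s · adj s = u` in the commutant order over `𝒪_E` -/

section NormEquation

variable {E : Type*} [Field E] [ValuativeRel E] {N : ℕ} (σO : 𝒪[E] →+* 𝒪[E]) (J : Matrix (Fin N) (Fin N) 𝒪[E])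
  (γ : Matrix (Fin N) (Fin N) 𝒪[E])

/-- A ring involution of the local ring `𝒪_E` preserves the maximal ideal. [cite: Serre1979, Ch. V §2] -/
theorem map_mem_maximalIdeal_of_involutive (hσσ : ∀ a, σO (σO a) = a) {m : 𝒪[E]} (hm : m ∈ maximalIdeal 𝒪[E]) :
    σO m ∈ maximalIdeal 𝒪[E] := by
  rw [IsLocalRing.mem_maximalIdeal, mem_nonunits_iff] at hm ⊢
  intro h
  exact hm (by simpa only [hσσ] using h.map σO)

/-- **The involution transported to the commutative model**: for `γ` residually separable and unitary there are an `𝒪_E`-algebra isomorphism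
`e : AdjoinRoot χ_γ ≃ₐ Z_{M_N(𝒪)}(γ)` with `e (mk p) = p(γ)` (★ K1) and a RING involution `σ'` of `AdjoinRoot χ_γ` with `e (σ' z) = adj (e z)` and
`σ' (of m) = of (σO m)` — `adj` restricted to the commutative `adj`-stable ring `Z(γ)` is a ring homomorphism. [cite: Kottwitz1986, §7 Prop. 7.1] -/
theorem exists_ringHom_adjoinRoot_adj (hσσ : ∀ a, σO (σO a) = a) (hJ : (J.map σO)ᵀ = J) (hJu : IsUnit J.det)
    (hsep : (γ.charpoly.map (IsLocalRing.residue 𝒪[E])).Separable) (hγ : (γ.map σO)ᵀ * J * γ = J) :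
    ∃ (e : AdjoinRoot γ.charpoly ≃ₐ[𝒪[E]] ↥(Subalgebra.centralizer 𝒪[E] ({γ} : Set (Matrix (Fin N) (Fin N) 𝒪[E]))))
      (σ' : AdjoinRoot γ.charpoly →+* AdjoinRoot γ.charpoly),
      (∀ p : 𝒪[E][X], ((e (AdjoinRoot.mk γ.charpoly p) : ↥(Subalgebra.centralizer 𝒪[E] ({γ} : Set (Matrix (Fin N) (Fin N) 𝒪[E])))) :
        Matrix (Fin N) (Fin N) 𝒪[E]) = aeval γ p) ∧
      (∀ z, ((e (σ' z) : ↥(Subalgebra.centralizer 𝒪[E] ({γ} : Set (Matrix (Fin N) (Fin N) 𝒪[E])))) : Matrix (Fin N) (Fin N) 𝒪[E]) =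
        J⁻¹ * (((e z : ↥(Subalgebra.centralizer 𝒪[E] ({γ} : Set (Matrix (Fin N) (Fin N) 𝒪[E])))) : Matrix (Fin N) (Fin N) 𝒪[E]).map σO)ᵀ * J) ∧
      (∀ z, σ' (σ' z) = z) ∧ (∀ m : 𝒪[E], σ' (AdjoinRoot.of γ.charpoly m) = AdjoinRoot.of γ.charpoly (σO m)) := by
  obtain ⟨e, he⟩ := exists_algEquiv_adjoinRoot_centralizer γ hsep
  -- membership in the centraliser = commuting with `γ`
  have hmem : ∀ {x : Matrix (Fin N) (Fin N) 𝒪[E]}, x ∈ Subalgebra.centralizer 𝒪[E] ({γ} : Set (Matrix (Fin N) (Fin N) 𝒪[E])) ↔ Commute γ x := by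
    intro x
    rw [Subalgebra.mem_centralizer_iff]
    simp only [Set.mem_singleton_iff, forall_eq]
    rfl
  -- `adj` on the centraliser
  let f : ↥(Subalgebra.centralizer 𝒪[E] ({γ} : Set (Matrix (Fin N) (Fin N) 𝒪[E]))) →
      ↥(Subalgebra.centralizer 𝒪[E] ({γ} : Set (Matrix (Fin N) (Fin N) 𝒪[E]))) :=
    fun x => ⟨J⁻¹ * ((x : Matrix (Fin N) (Fin N) 𝒪[E]).map σO)ᵀ * J, hmem.2 (commute_adj_of_commute σO J hJu hγ (hmem.1 x.2))⟩
  have hf : ∀ x, ((f x : ↥(Subalgebra.centralizer 𝒪[E] ({γ} : Set (Matrix (Fin N) (Fin N) 𝒪[E])))) : Matrix (Fin N) (Fin N) 𝒪[E]) =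
      J⁻¹ * ((x : Matrix (Fin N) (Fin N) 𝒪[E]).map σO)ᵀ * J := fun _ => rfl
  have hf_mul : ∀ x y, f (x * y) = f x * f y := by
    intro x y
    apply Subtype.ext
    rw [Subalgebra.coe_mul, hf, hf, hf, Subalgebra.coe_mul, adj_mul σO J hJu]
    -- `adj y * adj x = adj x * adj y`: both commute with `γ`
    exact (commute_of_commute_residuallySeparable γ hsep (hmem.1 (f y).2) (hmem.1 (f x).2)).eq
  let σ' : AdjoinRoot γ.charpoly →+* AdjoinRoot γ.charpoly :=
    { toFun := fun z => e.symm (f (e z))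
      map_one' := by
        rw [map_one]
        have : f 1 = 1 := Subtype.ext (by rw [hf, Subalgebra.coe_one, adj_one σO J hJu])
        rw [this, map_one]
      map_mul' := fun z w => by rw [map_mul, hf_mul, map_mul]
      map_zero' := by
        rw [map_zero]
        have : f 0 = 0 := Subtype.ext (by rw [hf, Subalgebra.coe_zero, adj_zero σO J])
        rw [this, map_zero]
      map_add' := fun z w => by
        rw [map_add]
        have : f (e z + e w) = f (e z) + f (e w) := Subtype.ext (by
          rw [hf, Subalgebra.coe_add, Subalgebra.coe_add, hf, hf, adj_add σO J])
        rw [this, map_add] }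
  have hσ' : ∀ z, σ' z = e.symm (f (e z)) := fun _ => rfl
  refine ⟨e, σ', he, fun z => ?_, fun z => ?_, fun m => ?_⟩
  · rw [hσ', AlgEquiv.apply_symm_apply, hf]
  · rw [hσ', hσ', AlgEquiv.apply_symm_apply]
    have : f (f (e z)) = e z := Subtype.ext (by rw [hf, hf, adj_adj σO J hσσ hJ hJu])
    rw [this, AlgEquiv.symm_apply_apply]
  · rw [hσ']
    apply e.injective
    rw [AlgEquiv.apply_symm_apply]
    apply Subtype.ext
    rw [hf, ← AdjoinRoot.algebraMap_eq, AlgEquiv.commutes, AlgEquiv.commutes, Subalgebra.coe_algebraMap, Subalgebra.coe_algebraMap]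
    exact adj_algebraMap σO J hJu m

variable [UniformSpace E] [IsUniformAddGroup E] [IsNonarchimedeanLocalField E]

/-- **KOTTWITZ'S NORM EQUATION IN THE COMMUTANT ORDER, matrix currency.**  Let `σO` be a ring involution of `𝒪_E` moving some element by a unit
(`hmove`; at an inert place of a quadratic extension ★ `exists_isUnit_map_sub_of_residueHom_ne`), `J ∈ GL_N(𝒪_E)` `σ`-hermitian, `γ ∈ U(J)(𝒪_E)`
(`ᵗ(σγ) J γ = J`) RESIDUALLY SEPARABLE (`χ̄_γ` separable).  Then for every `u ∈ Z(γ)` with `det u ∈ 𝒪ˣ` fixed by `adj` (`J⁻¹ ᵗ(σu) J = u`) there is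
`s ∈ Z(γ)` with `det s ∈ 𝒪ˣ` and **`s · (J⁻¹ ᵗ(σs) J) = u`** — ★ K1 `exists_mul_map_eq_adjoinRoot` on `AdjoinRoot χ_γ` with the transported involution `σ'`
(it preserves `𝔪 · AdjoinRoot χ_γ`, and moves the scalar `of c` by the unit `of (σO c − c)`). [cite: Kottwitz1986, §7 Prop. 7.1] [cite: Rogawski1990, §4.3 p. 43] -/
theorem exists_commute_mul_adj_eq (hσσ : ∀ a, σO (σO a) = a) (hmove : ∃ c : 𝒪[E], IsUnit (σO c - c))
    (hJ : (J.map σO)ᵀ = J) (hJu : IsUnit J.det)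
    (hsep : (γ.charpoly.map (IsLocalRing.residue 𝒪[E])).Separable) (hγ : (γ.map σO)ᵀ * J * γ = J)
    (u : Matrix (Fin N) (Fin N) 𝒪[E]) (hu : Commute γ u) (huu : IsUnit u.det) (hτu : J⁻¹ * (u.map σO)ᵀ * J = u) :
    ∃ s : Matrix (Fin N) (Fin N) 𝒪[E], Commute γ s ∧ IsUnit s.det ∧ s * (J⁻¹ * (s.map σO)ᵀ * J) = u := by
  obtain ⟨e, σ', he, hadj, hσ'σ', hof⟩ := exists_ringHom_adjoinRoot_adj σO J γ hσσ hJ hJu hsep hγ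
  have hmem : ∀ {x : Matrix (Fin N) (Fin N) 𝒪[E]}, x ∈ Subalgebra.centralizer 𝒪[E] ({γ} : Set (Matrix (Fin N) (Fin N) 𝒪[E])) ↔ Commute γ x := by
    intro x
    rw [Subalgebra.mem_centralizer_iff]
    simp only [Set.mem_singleton_iff, forall_eq]
    rfl
  have hχ : γ.charpoly.Monic := Matrix.charpoly_monic γ
  -- `σ'` preserves `𝔪 · AdjoinRoot χ_γ`
  have hcomp : σ'.comp (AdjoinRoot.of γ.charpoly) = (AdjoinRoot.of γ.charpoly).comp σO := RingHom.ext fun m => by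
    rw [RingHom.comp_apply, RingHom.comp_apply, hof]
  have hσI : ∀ a ∈ (maximalIdeal 𝒪[E]).map (AdjoinRoot.of γ.charpoly), σ' a ∈ (maximalIdeal 𝒪[E]).map (AdjoinRoot.of γ.charpoly) := by
    intro a ha
    have h1 : σ' a ∈ ((maximalIdeal 𝒪[E]).map (AdjoinRoot.of γ.charpoly)).map σ' := Ideal.mem_map_of_mem σ' ha
    rw [Ideal.map_map, hcomp, ← Ideal.map_map] at h1
    exact Ideal.map_mono (Ideal.map_le_iff_le_comap.2 fun m hm => Ideal.mem_comap.2 (map_mem_maximalIdeal_of_involutive σO hσσ hm)) h1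
  -- `σ'` moves the scalar `of c` by a unit
  obtain ⟨c, hc⟩ := hmove
  have ha : IsUnit (σ' (AdjoinRoot.of γ.charpoly c) - AdjoinRoot.of γ.charpoly c) := by
    rw [hof, ← map_sub]
    exact hc.map _
  -- the unit `U` of `AdjoinRoot χ` attached to `u`
  have huinv : Commute γ u⁻¹ := by
    change γ * u⁻¹ = u⁻¹ * γ
    calc γ * u⁻¹ = u⁻¹ * (u * γ) * u⁻¹ := by rw [Matrix.nonsing_inv_mul_cancel_left _ _ huu]
      _ = u⁻¹ * (γ * u) * u⁻¹ := by rw [hu.eq]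
      _ = u⁻¹ * γ := by rw [Matrix.mul_assoc, Matrix.mul_nonsing_inv_cancel_right _ _ huu]
  let uZ : ↥(Subalgebra.centralizer 𝒪[E] ({γ} : Set (Matrix (Fin N) (Fin N) 𝒪[E]))) := ⟨u, hmem.2 hu⟩
  let uZ' : ↥(Subalgebra.centralizer 𝒪[E] ({γ} : Set (Matrix (Fin N) (Fin N) 𝒪[E]))) := ⟨u⁻¹, hmem.2 huinv⟩
  have hUU' : e.symm uZ * e.symm uZ' = 1 := by
    rw [← map_mul, ← map_one e.symm]
    congr 1
    exact Subtype.ext (by rw [Subalgebra.coe_mul, Subalgebra.coe_one]; exact Matrix.mul_nonsing_inv _ huu)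
  have hU : IsUnit (e.symm uZ) := IsUnit.of_mul_eq_one _ hUU'
  have hσU : σ' (e.symm uZ) = e.symm uZ := by
    apply e.injective
    apply Subtype.ext
    rw [hadj, AlgEquiv.apply_symm_apply]
    exact hτu
  -- solve in `AdjoinRoot χ`
  obtain ⟨S, hS⟩ := exists_mul_map_eq_adjoinRoot γ.charpoly hχ hsep σ' hσ'σ' hσI ha (e.symm uZ) hU hσU
  refine ⟨(e S : ↥(Subalgebra.centralizer 𝒪[E] ({γ} : Set (Matrix (Fin N) (Fin N) 𝒪[E])))), hmem.1 (e S).2, ?_, ?_⟩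
  · -- `det s · det (adj s) = det u ∈ 𝒪ˣ`
    have h := congrArg (fun z => ((e z : ↥(Subalgebra.centralizer 𝒪[E] ({γ} : Set (Matrix (Fin N) (Fin N) 𝒪[E])))) :
      Matrix (Fin N) (Fin N) 𝒪[E])) hS
    simp only [map_mul, Subalgebra.coe_mul, AlgEquiv.apply_symm_apply] at h
    have hdet := congrArg Matrix.det h
    rw [Matrix.det_mul] at hdet
    exact isUnit_of_mul_isUnit_left (hdet ▸ huu)
  · have h := congrArg (fun z => ((e z : ↥(Subalgebra.centralizer 𝒪[E] ({γ} : Set (Matrix (Fin N) (Fin N) 𝒪[E])))) :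
      Matrix (Fin N) (Fin N) 𝒪[E])) hS
    simp only [map_mul, Subalgebra.coe_mul, AlgEquiv.apply_symm_apply] at h
    rw [hadj] at h
    exact h

/-- **… and in the other order**: `(J⁻¹ ᵗ(σs) J) · s = u` (the commutant is commutative). [cite: Kottwitz1986, §7 Prop. 7.1] -/
theorem exists_commute_adj_mul_eq (hσσ : ∀ a, σO (σO a) = a) (hmove : ∃ c : 𝒪[E], IsUnit (σO c - c))
    (hJ : (J.map σO)ᵀ = J) (hJu : IsUnit J.det)
    (hsep : (γ.charpoly.map (IsLocalRing.residue 𝒪[E])).Separable) (hγ : (γ.map σO)ᵀ * J * γ = J)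
    (u : Matrix (Fin N) (Fin N) 𝒪[E]) (hu : Commute γ u) (huu : IsUnit u.det) (hτu : J⁻¹ * (u.map σO)ᵀ * J = u) :
    ∃ s : Matrix (Fin N) (Fin N) 𝒪[E], Commute γ s ∧ IsUnit s.det ∧ (J⁻¹ * (s.map σO)ᵀ * J) * s = u := by
  obtain ⟨s, hs, hsu, h⟩ := exists_commute_mul_adj_eq σO J γ hσσ hmove hJ hJu hsep hγ u hu huu hτu
  refine ⟨s, hs, hsu, ?_⟩
  rw [← h]
  exact (commute_of_commute_residuallySeparable γ hsep (commute_adj_of_commute σO J hJu hγ hs) hs).eq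

end NormEquation

end Literature.NumberTheory.LocalFields

end
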